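import Mathlib
import Summits.NavierStokesRegularity.NavierStokesRegularity.Theorems.EulerZoomLiouvillePowerGaugeEulerLiouvilleMeanStrainTools
import HarnessLib

/-!
# Crux `EulerZoomLiouville.PowerGaugeEulerLiouville` (stmt-NavierStokesRegularity-19832): tools for THE FORWARD ESCAPE LAW (plate t59-ESC of nsreg-p2 ROUND-54 «THE TRACE»)

Width/portrait helper (seat ns-ezl-w3 g8, `--supports stmt-NavierStokesRegularity-19832 --as helper`; text custody nsreg-p2 g44, `r54/Sketch54.lean`
sha16 f78682d2f4ee3f27, `NsregP2.R54.Trace.ForwardEscapeLaw`).  The VELOCITY twin of ns-sfl-p1 g9's strain slice (`…MeanStrainTools/…MeanStrain`), in the lineage's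
cut-off idiom (`V′ ∈ C²`, `‖DV′‖ ≤ K`, `V′ = V` on `ball 0 Rbig`, flow `Ψ_s = ODE.evolutionMap (fun _ => selfSimilarTransport γ 0 V′) 0 s`, `γ = 1/(2+ρ)`):

* `Trace.lintegral_closedBall_normSq_le_of_gauge` — the `A`-gauge on CLOSED balls: `∫_{B̄_r}‖V‖² ≤ A·r^{1−2ρ}` for `r ≥ 1`, from the open-ball budget by right-continuity
  (`R ↓ r`), so no `2^{1−2ρ}` is lost;
* ★ `Trace.lintegral_velocitySq_slice_le` — **the kinetic energy of the staying labels at a fixed time**: for `σ ∈ [0,S]`,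
  `∫_{stay(σ) ∩ B_L} ‖V′(Ψ_σ y)‖² dy ≤ e^{−3γσ}·A·(CLe^{γσ})^{1−2ρ}` (area formula `lintegral_comp_flow_section_eq` with Jacobian `e^{3γσ}`, image inside
  `B̄(0, CLe^{γσ})` where `V′ = V`, then the closed-ball gauge);
* `Trace.escape_bookkeeping` — `e^{(1−2γ)σ}·e^{−3γσ}·(CLe^{γσ})^{1−2ρ} = (CL)^{1−2ρ}·e^{−σ}` (`(1−2γ) − 3γ + γ(1−2ρ) = −1`, Sketch54 `escapeExponent`);
* `Trace.lintegral_exp_neg_Icc_le_one` — `∫_{[0,S]} e^{−σ}dσ ≤ 1`.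

HONEST FRAMING: bookkeeping about HYPOTHETICAL profiles / smooth cut-off fields; nothing about the crux E (19832 OPEN) or NS regularity is proved here; not E.
[nsreg-p2 R54 §C t59-ESC; cite: ConstantinIgnatovaVicol2026Putative, §3.4.1 eq. (3.21)–(3.22)]
-/

noncomputable section

set_option linter.dupNamespace false

open MeasureTheory Set Filter Topology Metric Function
open scoped RealInnerProductSpace NNReal ENNReal ContDiff Topology

namespace Summit.NavierStokesRegularity.NavierStokesRegularity.Theorems.PowerGaugeEulerLiouville.Trace

open Literature.Analysis Literature.Analysis.FluidPDE
open Summit.NavierStokesRegularity.NavierStokesRegularity.Theorems.PowerGaugeEulerLiouville.BernoulliLandscape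
open Summit.NavierStokesRegularity.NavierStokesRegularity.Theorems.PowerGaugeEulerLiouville.NeedleFeeding

/-! ### The `A`-gauge on closed balls -/

/-- **The `A`-gauge on closed balls** (`V` continuous, `r ≥ 1`): `∫_{B̄_r}‖V‖² ≤ A·r^{1−2ρ}` — from the open-ball budget at every `R > r` and right-continuity
of `R ↦ A·R^{1−2ρ}`. [folklore] -/
theorem lintegral_closedBall_normSq_le_of_gauge {ρ A : ℝ} {V : EuclideanSpace ℝ (Fin 3) → EuclideanSpace ℝ (Fin 3)} (hV : Continuous V)
    (hA : ∀ R : ℝ, 1 ≤ R → ∫ y in ball (0 : EuclideanSpace ℝ (Fin 3)) R, ‖V y‖ ^ 2 ≤ A * R ^ (1 - 2 * ρ)) {r : ℝ} (hr : 1 ≤ r) :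
    ∫⁻ z in closedBall (0 : EuclideanSpace ℝ (Fin 3)) r, ‖V z‖ₑ ^ 2 ≤ ENNReal.ofReal (A * r ^ (1 - 2 * ρ)) := by
  have hr0 : 0 < r := by linarith
  -- at every `R > r`
  have hR : ∀ R : ℝ, r < R → ∫⁻ z in closedBall (0 : EuclideanSpace ℝ (Fin 3)) r, ‖V z‖ₑ ^ 2 ≤ ENNReal.ofReal (A * R ^ (1 - 2 * ρ)) := by
    intro R hrR
    have hint : IntegrableOn (fun y => ‖V y‖ ^ 2) (ball (0 : EuclideanSpace ℝ (Fin 3)) R) :=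
      ((hV.norm.pow 2).continuousOn.integrableOn_compact (isCompact_closedBall (0 : EuclideanSpace ℝ (Fin 3)) R)).mono_set
        ball_subset_closedBall
    have e : ∫⁻ z in ball (0 : EuclideanSpace ℝ (Fin 3)) R, ‖V z‖ₑ ^ 2 =
        ENNReal.ofReal (∫ y in ball (0 : EuclideanSpace ℝ (Fin 3)) R, ‖V y‖ ^ 2) := by
      rw [ofReal_integral_eq_lintegral_ofReal hint (ae_of_all _ fun y => by positivity)]
      refine lintegral_congr fun y => ?_
      rw [← ofReal_norm, ENNReal.ofReal_pow (norm_nonneg _)]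
    calc ∫⁻ z in closedBall (0 : EuclideanSpace ℝ (Fin 3)) r, ‖V z‖ₑ ^ 2
        ≤ ∫⁻ z in ball (0 : EuclideanSpace ℝ (Fin 3)) R, ‖V z‖ₑ ^ 2 := lintegral_mono_set (closedBall_subset_ball hrR)
      _ = ENNReal.ofReal (∫ y in ball (0 : EuclideanSpace ℝ (Fin 3)) R, ‖V y‖ ^ 2) := e
      _ ≤ ENNReal.ofReal (A * R ^ (1 - 2 * ρ)) := ENNReal.ofReal_le_ofReal (hA R (by linarith))
  -- right-continuity at `r`
  have hcont : Tendsto (fun R : ℝ => ENNReal.ofReal (A * R ^ (1 - 2 * ρ))) (𝓝[>] r) (𝓝 (ENNReal.ofReal (A * r ^ (1 - 2 * ρ)))) := by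
    have h1 : ContinuousAt (fun R : ℝ => A * R ^ (1 - 2 * ρ)) r :=
      continuousAt_const.mul (Real.continuousAt_rpow_const _ _ (Or.inl hr0.ne'))
    exact (ENNReal.continuous_ofReal.continuousAt.comp h1).continuousWithinAt
  exact ge_of_tendsto hcont (eventually_nhdsWithin_of_forall fun R hR' => hR R hR')

/-! ### The kinetic energy of the staying labels at a fixed time -/

/-- ★ **The kinetic energy of the staying labels at time `σ`.**  In the cut-off idiom, for `σ ∈ [0, S]` the labels `y ∈ B_L` whose orbit stays in the `CL`-tube on `[0, σ]`
satisfy `∫ ‖V′(Ψ_σ y)‖² dy ≤ e^{−3γσ}·A·(CLe^{γσ})^{1−2ρ}`: area formula with Jacobian `e^{3γσ}`, image in `B̄(0, CLe^{γσ})` where `V′ = V`, closed-ball gauge.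
[nsreg-p2 R54 §C t59-ESC; cite: ConstantinIgnatovaVicol2026Putative, §3.4.1 eq. (3.22)] -/
theorem lintegral_velocitySq_slice_le {ρ : ℝ} (hρ : -2 < ρ)
    {V V' : EuclideanSpace ℝ (Fin 3) → EuclideanSpace ℝ (Fin 3)} {P : EuclideanSpace ℝ (Fin 3) → ℝ}
    (hprof : IsSelfSimilarEulerProfile (1 / (2 + ρ)) 0 V P) {A : ℝ}
    (hA : ∀ R : ℝ, 1 ≤ R → ∫ y in ball (0 : EuclideanSpace ℝ (Fin 3)) R, ‖V y‖ ^ 2 ≤ A * R ^ (1 - 2 * ρ))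
    {C L S K Rbig : ℝ} (hC : 1 ≤ C) (hL : 1 ≤ L)
    (hV' : ContDiff ℝ 2 V') (hK : ∀ y, ‖fderiv ℝ V' y‖ ≤ K) (hRbig : 2 * C * L * Real.exp (S / (2 + ρ)) < Rbig)
    (hVV' : ∀ w ∈ ball (0 : EuclideanSpace ℝ (Fin 3)) Rbig, V' w = V w) {σ : ℝ} (hσ : σ ∈ Icc 0 S) :
    ∫⁻ y in {y ∈ ball (0 : EuclideanSpace ℝ (Fin 3)) L | ∀ σ' ∈ Icc 0 σ,
        ‖ODE.evolutionMap (fun _ : ℝ => selfSimilarTransport (1 / (2 + ρ)) (0 : EuclideanSpace ℝ (Fin 3)) V') 0 σ' y‖ ≤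
          C * L * Real.exp (σ' / (2 + ρ))},
        ‖V' (ODE.evolutionMap (fun _ : ℝ => selfSimilarTransport (1 / (2 + ρ)) (0 : EuclideanSpace ℝ (Fin 3)) V') 0 σ y)‖ₑ ^ 2 ≤
      ENNReal.ofReal (Real.exp (-(3 * (1 / (2 + ρ)) * σ)) * (A * (C * L * Real.exp (σ / (2 + ρ))) ^ (1 - 2 * ρ))) := by
  have h2ρ : 0 < 2 + ρ := by linarith
  set γ : ℝ := 1 / (2 + ρ) with hγ
  have hCL : 1 ≤ C * L := by nlinarith
  have hCL0 : 0 ≤ C * L := by linarith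
  obtain ⟨Φ, hΦ⟩ : ∃ Φ : ℝ → EuclideanSpace ℝ (Fin 3) → EuclideanSpace ℝ (Fin 3),
      Φ = ODE.evolutionMap (fun _ : ℝ => selfSimilarTransport γ (0 : EuclideanSpace ℝ (Fin 3)) V') 0 := ⟨_, rfl⟩
  set Rσ : ℝ := C * L * Real.exp (σ / (2 + ρ)) with hRσ
  set RS : ℝ := C * L * Real.exp (S / (2 + ρ)) with hRS
  have hRσ1 : 1 ≤ Rσ := by
    have : 1 ≤ Real.exp (σ / (2 + ρ)) := Real.one_le_exp (div_nonneg hσ.1 h2ρ.le)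
    nlinarith
  have hRσ0 : 0 < Rσ := by linarith
  have hσS : Rσ ≤ RS := by
    have : Real.exp (σ / (2 + ρ)) ≤ Real.exp (S / (2 + ρ)) :=
      Real.exp_le_exp.2 (div_le_div_of_nonneg_right hσ.2 h2ρ.le)
    exact mul_le_mul_of_nonneg_left this hCL0
  have hRSbig : RS < Rbig := by
    have : 0 ≤ RS := by positivity
    linarith
  -- `V′ = V` on `‖z‖ ≤ RS`, so `V′` is divergence-free there
  have hVeq : ∀ z : EuclideanSpace ℝ (Fin 3), ‖z‖ ≤ RS → V' z = V z := by
    intro z hz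
    exact hVV' z (by rw [mem_ball_zero_iff]; exact lt_of_le_of_lt hz hRSbig)
  have hfd : ∀ z : EuclideanSpace ℝ (Fin 3), ‖z‖ ≤ RS → fderiv ℝ V' z = fderiv ℝ V z := by
    intro z hz
    have hzB : z ∈ ball (0 : EuclideanSpace ℝ (Fin 3)) Rbig := by
      rw [mem_ball_zero_iff]; exact lt_of_le_of_lt hz hRSbig
    have hEq : V' =ᶠ[𝓝 z] V := Filter.eventually_of_mem (isOpen_ball.mem_nhds hzB) fun w hw => hVV' w hw
    exact hEq.fderiv_eq
  have hdiv : ∀ z : EuclideanSpace ℝ (Fin 3), ‖z‖ ≤ RS → VectorCalculus.divergence V' z = 0 := by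
    intro z hz
    have h0 := hprof.divFree z
    unfold VectorCalculus.divergence at h0 ⊢
    rw [hfd z hz]; exact h0
  -- the label set
  obtain ⟨F, hF⟩ : ∃ F : Set (EuclideanSpace ℝ (Fin 3)), F = {y ∈ ball (0 : EuclideanSpace ℝ (Fin 3)) L |
      ∀ σ' ∈ Icc 0 σ, ‖Φ σ' y‖ ≤ C * L * Real.exp (σ' / (2 + ρ))} := ⟨_, rfl⟩
  have hFm : MeasurableSet F := by
    rw [hF, show {y ∈ ball (0 : EuclideanSpace ℝ (Fin 3)) L | ∀ σ' ∈ Icc 0 σ, ‖Φ σ' y‖ ≤ C * L * Real.exp (σ' / (2 + ρ))} =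
      ball (0 : EuclideanSpace ℝ (Fin 3)) L ∩ {y | ∀ σ' ∈ Icc 0 σ, ‖Φ σ' y‖ ≤ C * L * Real.exp (σ' / (2 + ρ))} by
        ext y; simp only [mem_setOf_eq, mem_inter_iff]]
    rw [hΦ]
    exact measurableSet_ball.inter
      (isClosed_forwardStay_fun (γ := γ) hV' hK σ (fun σ' => C * L * Real.exp (σ' / (2 + ρ)))).measurableSet
  have hstay : ∀ y ∈ F, ∀ σ' ∈ Icc 0 σ, ‖Φ σ' y‖ ≤ RS := by
    intro y hy σ' hσ'
    rw [hF] at hy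
    refine (hy.2 σ' hσ').trans ?_
    have : Real.exp (σ' / (2 + ρ)) ≤ Real.exp (S / (2 + ρ)) :=
      Real.exp_le_exp.2 (div_le_div_of_nonneg_right (hσ'.2.trans hσ.2) h2ρ.le)
    exact mul_le_mul_of_nonneg_left this hCL0
  have himg : Φ σ '' F ⊆ closedBall (0 : EuclideanSpace ℝ (Fin 3)) Rσ := by
    rintro _ ⟨y, hy, rfl⟩
    rw [mem_closedBall_zero_iff]
    rw [hF] at hy
    exact hy.2 σ ⟨hσ.1, le_rfl⟩
  -- the area formula for `g = ‖V′‖ₑ²`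
  have hgm : Measurable fun z : EuclideanSpace ℝ (Fin 3) => ‖V' z‖ₑ ^ 2 := (hV'.continuous.measurable.enorm).pow_const 2
  have harea := lintegral_comp_flow_section_eq (γ := γ) hV' hK hσ.1 hdiv hFm (by rw [hΦ] at hstay; exact hstay) hgm
  rw [← hΦ] at harea
  have hAeq : ∫⁻ y in F, ‖V' (Φ σ y)‖ₑ ^ 2 = ENNReal.ofReal (Real.exp (-(3 * γ * σ))) * ∫⁻ z in Φ σ '' F, ‖V' z‖ₑ ^ 2 := by
    rw [← harea, ← mul_assoc, ← ENNReal.ofReal_mul (Real.exp_pos _).le, ← Real.exp_add,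
      show -(3 * γ * σ) + 3 * γ * σ = 0 by ring, Real.exp_zero, ENNReal.ofReal_one, one_mul]
  have hB : ∫⁻ z in Φ σ '' F, ‖V' z‖ₑ ^ 2 ≤ ∫⁻ z in closedBall (0 : EuclideanSpace ℝ (Fin 3)) Rσ, ‖V z‖ₑ ^ 2 := by
    refine (lintegral_mono_set himg).trans (le_of_eq ?_)
    refine setLIntegral_congr_fun measurableSet_closedBall (fun z hz => ?_)
    rw [mem_closedBall_zero_iff] at hz
    rw [hVeq z (hz.trans hσS)]
  have hC' : ∫⁻ z in closedBall (0 : EuclideanSpace ℝ (Fin 3)) Rσ, ‖V z‖ₑ ^ 2 ≤ ENNReal.ofReal (A * Rσ ^ (1 - 2 * ρ)) :=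
    lintegral_closedBall_normSq_le_of_gauge hprof.contDiff_velocity.continuous hA hRσ1
  -- assemble
  have hfin : ∫⁻ y in F, ‖V' (Φ σ y)‖ₑ ^ 2 ≤ ENNReal.ofReal (Real.exp (-(3 * γ * σ)) * (A * Rσ ^ (1 - 2 * ρ))) := by
    rw [hAeq, ENNReal.ofReal_mul (Real.exp_pos _).le]
    exact mul_le_mul_right (hB.trans hC') _
  rw [hF, hΦ] at hfin
  exact hfin

/-! ### Exponent bookkeeping and the time integral -/

/-- **The exponent identity `1 − 2γ(2+ρ) = −1` at work**: `e^{(1−2γ)σ}·(e^{−3γσ}·(CLe^{γσ})^{1−2ρ}) = (CL)^{1−2ρ}·e^{−σ}`, `γ = 1/(2+ρ)`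
(`(1−2γ) − 3γ + γ(1−2ρ) = 1 − 2γ(2+ρ) = −1`, Sketch54 `escapeExponent`). [folklore] -/
theorem escape_bookkeeping {ρ C L σ : ℝ} (h2ρ : 0 < 2 + ρ) (hCL : 0 ≤ C * L) :
    Real.exp ((1 - 2 * (1 / (2 + ρ))) * σ) * (Real.exp (-(3 * (1 / (2 + ρ)) * σ)) * (C * L * Real.exp (σ / (2 + ρ))) ^ (1 - 2 * ρ)) =
      (C * L) ^ (1 - 2 * ρ) * Real.exp (-σ) := by
  rw [Real.mul_rpow hCL (Real.exp_pos _).le, ← Real.exp_mul]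
  have e : (1 - 2 * (1 / (2 + ρ))) * σ + (-(3 * (1 / (2 + ρ)) * σ) + σ / (2 + ρ) * (1 - 2 * ρ)) = -σ := by
    field_simp
    ring
  calc Real.exp ((1 - 2 * (1 / (2 + ρ))) * σ) * (Real.exp (-(3 * (1 / (2 + ρ)) * σ)) *
        ((C * L) ^ (1 - 2 * ρ) * Real.exp (σ / (2 + ρ) * (1 - 2 * ρ))))
      = (C * L) ^ (1 - 2 * ρ) * (Real.exp ((1 - 2 * (1 / (2 + ρ))) * σ) *
          (Real.exp (-(3 * (1 / (2 + ρ)) * σ)) * Real.exp (σ / (2 + ρ) * (1 - 2 * ρ)))) := by ring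
    _ = (C * L) ^ (1 - 2 * ρ) * Real.exp (-σ) := by rw [← Real.exp_add, ← Real.exp_add, e]

/-- `∫_{[0,S]} e^{−σ} dσ ≤ 1` (`S ≥ 0`), in `ℝ≥0∞`. [folklore] -/
theorem lintegral_exp_neg_Icc_le_one {S : ℝ} (hS : 0 ≤ S) :
    ∫⁻ σ in Icc 0 S, ENNReal.ofReal (Real.exp (-σ)) ≤ 1 := by
  have hc : Continuous fun σ : ℝ => Real.exp (-σ) := by fun_prop
  have hint : IntegrableOn (fun σ : ℝ => Real.exp (-σ)) (Icc 0 S) volume := hc.continuousOn.integrableOn_compact isCompact_Icc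
  rw [← ofReal_integral_eq_lintegral_ofReal hint (ae_of_all _ fun σ => (Real.exp_pos _).le), ← ENNReal.ofReal_one]
  refine ENNReal.ofReal_le_ofReal ?_
  rw [integral_Icc_eq_integral_Ioc, ← intervalIntegral.integral_of_le hS]
  have hderiv : ∀ x ∈ uIcc 0 S, HasDerivAt (fun σ : ℝ => -Real.exp (-σ)) (Real.exp (-x)) x := by
    intro x _
    have h := ((hasDerivAt_neg x).exp).neg
    refine h.congr_deriv ?_
    ring
  rw [intervalIntegral.integral_eq_sub_of_hasDerivAt hderiv (hc.intervalIntegrable 0 S)]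
  simp only [neg_zero, Real.exp_zero]
  have hpos : 0 < Real.exp (-S) := Real.exp_pos _
  linarith

end Summit.NavierStokesRegularity.NavierStokesRegularity.Theorems.PowerGaugeEulerLiouville.Trace

end
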